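import Summits.QuantumFields.BalabanUV.T4Continuum.Support.SubstrateAvgTowerStructure

/-!
# SUBSTRATE — W-25a PART 1b = L-E19 (structure half, follower): the `dist1` bookkeeping of the accumulated correction with the one-step letter
# asked only BELOW the current level, and the STRONG-INDUCTION SKELETON `kappa_induction` that closes a κ-programme whose step at level `i` reads the
# accumulated corrections at the levels `≤ i` (located design point of NE5 leaf-04, `HOME/CLAIMS.log` l.23876 — OFFERED there to the substrate; [folklore])

Cell `pub-balaban`, SUBSTRATE cell, seat `b2b-balaban-substrate-p3` (gen 4).  Summits-side under the LEAN PLACEMENT RULE ([folklore] real∕group bookkeeping; nothing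
printed asserted; no citation tags).  Follower of PART 1 `SubstrateAvgTowerStructure` (p241207: `corrAcc`, `accBound`, `dist1_corrAcc_succ_le`, `avgTower`) BY NAME.

WHY.  PART 1's `dist1_corrAcc_le_accBound` ∕ `dist1_corrAcc_scaled_le` ∕ `dist1_corrAcc_le_of_hκ` take the one-step letter `dist1 (corr ℰ U_i c) ≤ κ i` at ALL steps
`i`; but `corrAcc ℰ V j` only READS the steps `i < j`, and the NE5 lineage's κ-programme (κ-L1…κ-L4 + κ-END, Q49 (a′)) PRODUCES the letter at step `i` from the
accumulated corrections at the levels `≤ i` — a strong induction.  This file states the below-`j` forms (same recursion) and the induction skeleton, so that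
κ-END is one positional application.

WHAT.  **`dist1_corrAcc_le_accBound_below`** (`(∀ i < j, ∀ c, dist1 (corr ℰ U_i c) ≤ κ i) → dist1 (corrAcc ℰ V j c) ≤ accBound L κ j`),
**`dist1_corrAcc_scaled_le_below`** (the `k`-indexed scaled form, letter asked for `i < j` only), **`dist1_corrAcc_le_of_hκ_below`** (the literal display:
`(∀ i < j, ∀ c, dist1 (corr …) ≤ κ∕(L^(K−1−i))²) → dist1 (corrAcc ℰ V j c) ≤ 2κ∕(L^(K−j))²`, `j ≤ K`, `L ≥ 2`), and **`kappa_induction`**: from a STEP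
`hstep : ∀ i < K, (∀ j ≤ i, ∀ b, dist1 (corrAcc ℰ V j b) ≤ 2κ∕(L^(K−j))²) → ∀ c, dist1 (corr ℰ U_i c) ≤ κ∕(L^(K−1−i))²` conclude the one-step letter at EVERY
`i < K` — PART 1's ∕ W-25b's displayed `hκ`.
HONEST FRAMING: rung (B)+1 of the FINITE-VOLUME T⁴ programme — NOT infinite volume, NOT a mass gap, NOT Clay; spine PROVED 0∕9; NE5 ∕ NE2 NOT PRINTED ∕ NOT
PROVED; bookkeeping only — the STEP is the NE5 lineage's estimate (displayed here), NO estimate is proved by the substrate; nothing of [Balaban1985Averaging] ∕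
[Balaban1987RG1] is discharged.  HONEST DEPENDENCY (cell line, verbatim): continuum YM on T⁴ ⇐ BetaPertH ∧ nine spine estimates (0/9 proved); BetaPertH ⇐ (D1) ∧
(D4) ∧ CAP+tail; G-an2-4 gates asym, D1 and NE2/3/4.  0 sorry; axioms ⊆ {propext, Classical.choice, Quot.sound}.
-/

noncomputable section

open scoped BigOperators

namespace Summit.QuantumFields.BalabanUV.T4Continuum.SubstrateAvgTowerStructureBelow

open Literature.MathematicalPhysics.QuantumFieldTheory.Balaban1983to89
open Literature.MathematicalPhysics.QuantumFieldTheory.Balaban1983to89.B5G183RateUnitTower (lev lev_neZero)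
open Literature.MathematicalPhysics.QuantumFieldTheory.Balaban1983to89.BlockAveraging (corr)
open Literature.MathematicalPhysics.QuantumFieldTheory.Balaban1983to89.AveragingRT (line)
open Summit.QuantumFields.BalabanUV.T4Continuum
open Summit.QuantumFields.BalabanUV.T4Continuum.BalabanAveragedTowerUnit (lev_succ' cast_lev' one_le_lev')
open Summit.QuantumFields.BalabanUV.T4Continuum.SubstrateAvgTowerStructure

variable {P : Params} {G : Type*} [GaugeGroup G] (ℰ : LoopAverage G)

/-- [folklore] **THE ACCUMULATED CORRECTION READS ONLY THE STEPS BELOW ITS LEVEL**: the one-step letter for `i < j` gives `dist1 (corrAcc ℰ V j c) ≤ accBound L κ j`. -/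
theorem dist1_corrAcc_le_accBound_below (V : GaugeField P 0 G) {κ : ℕ → ℝ} :
    ∀ (j : ℕ), (∀ i < j, ∀ c : PBond P (i + 1), dist1 (corr ℰ (avgTower ℰ V i) c) ≤ κ i) → ∀ c : PBond P j, dist1 (corrAcc ℰ V j c) ≤ accBound P.L κ j
  | 0, _, c => by rw [corrAcc_zero, GaugeGroup.dist1_one]; exact le_rfl
  | j + 1, hκ, c => by
      refine (dist1_corrAcc_succ_le ℰ V j c).trans ?_
      show _ ≤ κ j + P.L * accBound P.L κ j
      refine add_le_add (hκ j (Nat.lt_succ_self j) c) ?_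
      have IH := dist1_corrAcc_le_accBound_below V j (fun i hi c' => hκ i (Nat.lt_succ_of_lt hi) c')
      calc ∑ t ∈ Finset.range P.L, dist1 (corrAcc ℰ V j (line c t)) ≤ ∑ _t ∈ Finset.range P.L, accBound P.L κ j :=
            Finset.sum_le_sum fun t _ => IH _
        _ = P.L * accBound P.L κ j := by rw [Finset.sum_const, Finset.card_range, nsmul_eq_mul]

/-- [folklore] **THE SCALED FORM, LETTER BELOW THE LEVEL ONLY** (`i + 1 + k′ = K` indexes the step by the NE2 level of its coarse lattice): at `j + k = K`,
`(∀ i < j, …·ℓ_{k′}² ≤ κ) → dist1 (corrAcc ℰ V j c)·ℓ_k² ≤ 2κ` (`κ ≥ 0`, `L ≥ 2`). -/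
theorem dist1_corrAcc_scaled_le_below (hL : 2 ≤ P.L) (V : GaugeField P 0 G) {κ : ℝ} (hκ0 : 0 ≤ κ) :
    ∀ (j k : ℕ), j + k = P.K →
      (∀ i < j, ∀ k' : ℕ, i + 1 + k' = P.K → ∀ c : PBond P (i + 1), dist1 (corr ℰ (avgTower ℰ V i) c) * ((lev P.L k' : ℕ) : ℝ) ^ 2 ≤ κ) →
      ∀ c : PBond P j, dist1 (corrAcc ℰ V j c) * ((lev P.L k : ℕ) : ℝ) ^ 2 ≤ 2 * κ
  | 0, k, _, _, c => by rw [corrAcc_zero, GaugeGroup.dist1_one, zero_mul]; positivity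
  | j + 1, k, hjk, hκ, c => by
      have hL0 : (0 : ℝ) < P.L := by exact_mod_cast P.L_pos
      have hL2 : (2 : ℝ) ≤ P.L := by exact_mod_cast hL
      have IH : ∀ t, dist1 (corrAcc ℰ V j (line c t)) * ((lev P.L (k + 1) : ℕ) : ℝ) ^ 2 ≤ 2 * κ :=
        fun t => dist1_corrAcc_scaled_le_below hL V hκ0 j (k + 1) (by omega) (fun i hi k' hk' c' => hκ i (Nat.lt_succ_of_lt hi) k' hk' c') _
      have hstep := hκ j (Nat.lt_succ_self j) k hjk c
      have hline : ∀ t, dist1 (corrAcc ℰ V j (line c t)) * ((lev P.L k : ℕ) : ℝ) ^ 2 ≤ 2 * κ / (P.L : ℝ) ^ 2 := by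
        intro t
        have h := IH t
        rw [lev_succ', Nat.cast_mul, mul_pow] at h
        rw [le_div_iff₀ (by positivity)]
        calc dist1 (corrAcc ℰ V j (line c t)) * ((lev P.L k : ℕ) : ℝ) ^ 2 * (P.L : ℝ) ^ 2
            = dist1 (corrAcc ℰ V j (line c t)) * ((P.L : ℝ) ^ 2 * ((lev P.L k : ℕ) : ℝ) ^ 2) := by ring
          _ ≤ 2 * κ := h
      have h1 := dist1_corrAcc_succ_le ℰ V j c
      have h2κ : 2 * κ / (P.L : ℝ) ≤ κ := by rw [div_le_iff₀ hL0]; nlinarith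
      calc dist1 (corrAcc ℰ V (j + 1) c) * ((lev P.L k : ℕ) : ℝ) ^ 2
          ≤ (dist1 (corr ℰ (avgTower ℰ V j) c) + ∑ t ∈ Finset.range P.L, dist1 (corrAcc ℰ V j (line c t))) * ((lev P.L k : ℕ) : ℝ) ^ 2 :=
            mul_le_mul_of_nonneg_right h1 (by positivity)
        _ = dist1 (corr ℰ (avgTower ℰ V j) c) * ((lev P.L k : ℕ) : ℝ) ^ 2
              + ∑ t ∈ Finset.range P.L, dist1 (corrAcc ℰ V j (line c t)) * ((lev P.L k : ℕ) : ℝ) ^ 2 := by rw [add_mul, Finset.sum_mul]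
        _ ≤ κ + ∑ _t ∈ Finset.range P.L, 2 * κ / (P.L : ℝ) ^ 2 := add_le_add hstep (Finset.sum_le_sum fun t _ => hline t)
        _ = κ + (P.L : ℝ) * (2 * κ / (P.L : ℝ) ^ 2) := by rw [Finset.sum_const, Finset.card_range, nsmul_eq_mul]
        _ = κ + 2 * κ / (P.L : ℝ) := by rw [pow_two, ← mul_div_assoc, mul_div_mul_left _ _ hL0.ne']
        _ ≤ 2 * κ := by linarith

/-- [folklore] **THE LITERAL DISPLAY, LETTER BELOW THE LEVEL ONLY**: `(∀ i < j, ∀ c, dist1 (corr ℰ U_i c) ≤ κ∕(L^(K−1−i))²) → dist1 (corrAcc ℰ V j c) ≤ 2κ∕(L^(K−j))²`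
for `j ≤ K` (`κ ≥ 0`, `L ≥ 2`). -/
theorem dist1_corrAcc_le_of_hκ_below (hL : 2 ≤ P.L) (V : GaugeField P 0 G) {κ : ℝ} (hκ0 : 0 ≤ κ) {j : ℕ} (hj : j ≤ P.K)
    (hκ : ∀ i < j, ∀ c : PBond P (i + 1), dist1 (corr ℰ (avgTower ℰ V i) c) ≤ κ / ((P.L : ℝ) ^ (P.K - 1 - i)) ^ 2)
    (c : PBond P j) : dist1 (corrAcc ℰ V j c) ≤ 2 * κ / ((P.L : ℝ) ^ (P.K - j)) ^ 2 := by
  have hL0 : (0 : ℝ) < P.L := by exact_mod_cast P.L_pos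
  have hκ' : ∀ i < j, ∀ k' : ℕ, i + 1 + k' = P.K → ∀ c : PBond P (i + 1),
      dist1 (corr ℰ (avgTower ℰ V i) c) * ((lev P.L k' : ℕ) : ℝ) ^ 2 ≤ κ := by
    intro i hi k' hik c
    have h := hκ i hi c
    have hk : P.K - 1 - i = k' := by omega
    have hℓ : (0 : ℝ) < ((lev P.L k' : ℕ) : ℝ) ^ 2 := pow_pos (by exact_mod_cast one_le_lev' P.L k') 2
    rw [hk, ← cast_lev', le_div_iff₀ hℓ] at h
    exact h
  have h := dist1_corrAcc_scaled_le_below ℰ hL V hκ0 j (P.K - j) (by omega) hκ' c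
  rw [cast_lev'] at h
  rw [le_div_iff₀ (pow_pos (pow_pos hL0 _) 2)]
  exact h

/-- [folklore] **THE STRONG-INDUCTION SKELETON OF A κ-PROGRAMME**: if at every step `i < K` the one-step letter `dist1 (corr ℰ U_i c) ≤ κ∕(L^(K−1−i))²` follows from the
accumulated-correction bounds `dist1 (corrAcc ℰ V j b) ≤ 2κ∕(L^(K−j))²` at the levels `j ≤ i`, then the one-step letter holds at EVERY step `i < K` — PART 1's ∕
W-25b's DISPLAYED `hκ`.  (The STEP is the estimate; it is the NE5 lineage's κ-END and stays a hypothesis here.)  USAGE (typer (π13) rider (κ2)): a step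
lemma of the shape `∀ i < K, (∀ b, dist1 (corrAcc ℰ V i b) ≤ 2κ∕(L^(K−i))²) → ∀ c, dist1 (corr ℰ U_i c) ≤ κ∕(L^(K−1−i))²` (reading the accumulated bound at
the level `i` ONLY, as in NE5 leaf-04's probe) instantiates `hstep` by ONE positional application — `fun i hi hacc => step i hi (hacc i le_rfl)` — since
`hstep` hands the step ALL levels `j ≤ i`. -/
theorem kappa_induction (hL : 2 ≤ P.L) (V : GaugeField P 0 G) {κ : ℝ} (hκ0 : 0 ≤ κ)
    (hstep : ∀ i < P.K, (∀ j ≤ i, ∀ b : PBond P j, dist1 (corrAcc ℰ V j b) ≤ 2 * κ / ((P.L : ℝ) ^ (P.K - j)) ^ 2) →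
      ∀ c : PBond P (i + 1), dist1 (corr ℰ (avgTower ℰ V i) c) ≤ κ / ((P.L : ℝ) ^ (P.K - 1 - i)) ^ 2) :
    ∀ i < P.K, ∀ c : PBond P (i + 1), dist1 (corr ℰ (avgTower ℰ V i) c) ≤ κ / ((P.L : ℝ) ^ (P.K - 1 - i)) ^ 2 := by
  intro i
  induction i using Nat.strong_induction_on with
  | _ i IH =>
      intro hi c
      refine hstep i hi (fun j hj b => ?_) c
      exact dist1_corrAcc_le_of_hκ_below ℰ hL V hκ0 (by omega) (fun i' hi' c' => IH i' (by omega) (by omega) c') b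

end Summit.QuantumFields.BalabanUV.T4Continuum.SubstrateAvgTowerStructureBelow

end
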